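import Summits.ValiantsHypothesis.ValiantsHypothesis.Theses.BorderApolarity
import Literature.Computability.AlgebraicComplexity.Apolarity
import Literature.Computability.AlgebraicComplexity.DeterminantalComplexity
import Literature.Computability.AlgebraicComplexity.DeterminantalComplexityProofs

/-!
# Line `fixed-point-debordering` — skeleton for crux `FixedWitnessObstructionQP`
(stmt-ValiantsHypothesis-5778, route `BorderApolarity`)

Crux-plan skeleton (planner unit `cruxplan-stmt-ValiantsHypothesis-5778-fixed-point-deborder`,
2026-08-15).  Idea card `Cruxes/FixedWitnessObstructionQP/Ideas/fixed-point-debordering.md`,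
merged per triage r1-1/2/3 with `toric-face-debordering` (same lever), sharpened as the triagers
asked: (a) the transfer target is the EVENTUAL form of the dc-thesis (`DcPerEventuallySuperQP`),
not `DetQP.DetqpThesis` (i.o. form); (b) the structural hypothesis is FORM-level (a toric normal
form of the padded permanent), not the ideal-level crux `ToricFixedPoints`; (c) toricity and the
height bound are separate stubs.

DE-BORDER THE FIXED POINT, NOT THE PERMANENT.  A fixed witness `(P, J)` of the crux at `(n, m)`
is first normalised to a TORIC FORM of the padded permanent,
`pp = u · wHC_w^e (g · det_m)` (a translate of a weighted-homogeneous component of a translate of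
`det_m`; `stub_formToric`), whose weights can be taken of quasi-polynomial HEIGHT
`‖w‖_∞ ≤ 2^((log₂ m + c₀)^c₀)` (`stub_fixedHeightQP`, the load-bearing bet); a toric form of height
`B` is de-bordered by one-variable interpolation into an honest affine determinantal expression
of `per_n` of size `((m+1)(B+1))^e₀` (`stub_deborder`, set `X₀₀ = 1` at the end); inside the
quasi-polynomial window this makes `dc(per_n)` quasi-polynomial for all large `n`, contradicting
the eventual dc-thesis (`stub_dcPerEventuallySuperQP`, an EXTERNAL hypothesis shared with route
`DetQP`, strictly weaker than the crux since `dc ≥ border-dc`).  The composition is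
`line_reduction` (the four stub statements as explicit hypotheses; pure logic plus the
quasi-polynomial arithmetic `qpoly ∘ qpoly = qpoly`, `qp_compose`/`window_bound`, proved here) and
`FixedWitnessObstructionQP_of : FixedWitnessObstructionQP` (the stubs plugged in; concludes the crux
BY NAME).

Disproof.lean (gen 2) honoured: `crux_iff` below is the same `Iff.rfl` unfolding
(`FixedWitnessAt n m` is token-for-token `Disproof.WitnessExists n m`); `false_without_limsup` /
`false_without_orbit` — W1 and W3 are consumed inside `stub_formToric`/`stub_fixedHeightQP`, which
keep the FULL witness hypothesis: with W3 (or W1) dropped the Disproof's junk witnesses exist at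
every `m ≥ n`, and then the four stubs together would give `dc(per_n) ≤ qpoly(n)` (take `m = n`),
contradicting `stub_dcPerEventuallySuperQP` — i.e. the stub set is consistent only because the
witness notion is the honest one;
`not_crux_expWindow` / `crux_threshold_two` — the line never argues below the window: the
contradiction is produced by `stub_dcPerEventuallySuperQP` at a constant `c'` depending on `c`,
and Grenet's `dc(per_n) ≤ 2ⁿ − 1` is consistent with every stub (height-1 toric forms exist in the
Grenet region `m ≥ 2ⁿ − 1`, where the de-bordered bound `poly(m)` is vacuous);
`crux_iff_gctWindow` — the line factors X ⟸ (det-only structure) ∧ (eventual dc-thesis), it does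
not claim to beat the qp Mulmuley–Sohoni thesis by itself.  Negative lemma checked:
`Theorems/ToricFixedPoints/Negative/WithoutOrbitFalse.lean` (orbit clause load-bearing) — our
`stub_formToric` keeps W1.

Sorries: exactly the four `stub_*`.  Everything else is proved.
-/

namespace Summit.ValiantsHypothesis.ValiantsHypothesis.Cruxes.FixedWitnessObstructionQP.FixedPointDebordering

open Literature.Computability.AlgebraicComplexity
open Summit.ValiantsHypothesis.ValiantsHypothesis.Theses.BorderApolarity
open Filter
open scoped Matrix BigOperators

set_option linter.dupNamespace false

noncomputable section

/-! ## §0 Vocabulary — definitionally the crux's inline data (`crux_iff` is `Iff.rfl`) -/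

/-- The `rk` weight ordering the variables (`ℓ = (0,0)` and the `Y`-block first), verbatim. -/
def rk (n m : ℕ) [NeZero m] (p : Fin m × Fin m) : ℕ :=
  (if (m - n ≤ (p.1 : ℕ) ∧ m - n ≤ (p.2 : ℕ)) ∨ p = (0, 0) then 0 else m * m) + ((p.1 : ℕ) * m + (p.2 : ℕ))

/-- W4 of the crux: stability of `J` under `D ↦ linSubst Mᵀ D` for every `M ∈ H₀(n,m)`, verbatim. -/
def IsH0Stable (n m : ℕ) [NeZero m] (J : ℕ → Set (MvPolynomial (Fin m × Fin m) ℂ)) : Prop :=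
  ∀ A : Matrix.GeneralLinearGroup (Fin m × Fin m) ℂ,
    let M : Matrix (Fin m × Fin m) (Fin m × Fin m) ℂ := A
    (∀ i j : Fin m × Fin m, M j i ≠ 0 → rk n m j ≤ rk n m i) →
    (∀ i j : Fin m × Fin m, ((m - n ≤ (i.1 : ℕ) ∧ m - n ≤ (i.2 : ℕ)) ∨ i = (0, 0)) → j ≠ i → M j i = 0) →
    (∀ i k j l : Fin m, m - n ≤ (i : ℕ) → m - n ≤ (k : ℕ) → m - n ≤ (j : ℕ) → m - n ≤ (l : ℕ) →
      M (i, j) (i, j) * M (k, l) (k, l) = M (i, l) (i, l) * M (k, j) (k, j)) →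
    M (0, 0) (0, 0) ^ (m - n) * ∏ i ∈ Finset.univ.filter (fun i : Fin m => m - n ≤ (i : ℕ)), M (i, i) (i, i) = 1 →
    ∀ k ≤ m, ∀ D ∈ J k, linSubst (Fin m × Fin m) ℂ Mᵀ D ∈ J k

/-- The witness predicate W1 ∧ W2 ∧ W3 ∧ W4 ∧ W5 of the crux (`act ↦ apolarAction`, same nesting):
`P` a sequence in `GL·det_m`, `J` the degree-wise Kuratowski limit of its annihilators
(liminf W2, limsup W3), `H₀(n,m)`-stable (W4), apolar to the padded permanent in degrees `≤ m` (W5). -/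
def IsFixedWitness (n m : ℕ) [NeZero m] (P : ℕ → MvPolynomial (Fin m × Fin m) ℂ)
    (J : ℕ → Set (MvPolynomial (Fin m × Fin m) ℂ)) : Prop :=
  (∀ t : ℕ, P t ∈ glOrbit (Fin m × Fin m) ℂ (detPoly (Fin m) ℂ)) ∧
  (∀ k ≤ m, ∀ D ∈ J k, ∃ Ds : ℕ → MvPolynomial (Fin m × Fin m) ℂ,
      (∀ t, (Ds t).IsHomogeneous k ∧ apolarAction (Ds t) (P t) = 0) ∧
        Tendsto (fun t => coeffVec (Ds t)) atTop (nhds (coeffVec D))) ∧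
  (∀ k ≤ m, ∀ (D : MvPolynomial (Fin m × Fin m) ℂ) (φ : ℕ → ℕ) (Ds : ℕ → MvPolynomial (Fin m × Fin m) ℂ),
      StrictMono φ → (∀ t, (Ds t).IsHomogeneous k ∧ apolarAction (Ds t) (P (φ t)) = 0) →
        Tendsto (fun t => coeffVec (Ds t)) atTop (nhds (coeffVec D)) → D ∈ J k) ∧
  IsH0Stable n m J ∧
  (∀ k ≤ m, ∀ D ∈ J k, apolarAction D (paddedPerPoly ℂ n m) = 0)

/-- A Borel-fixed border-apolar witness exists at `(n, m)` (= `Disproof.WitnessExists n m`). -/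
def FixedWitnessAt (n m : ℕ) [NeZero m] : Prop :=
  ∃ (P : ℕ → MvPolynomial (Fin m × Fin m) ℂ) (J : ℕ → Set (MvPolynomial (Fin m × Fin m) ℂ)),
    IsFixedWitness n m P J

/-- **X unfolded** (`Iff.rfl`): beyond a threshold `n₀(c)` no fixed witness exists in the window
`n ≤ m ≤ 2^((log₂ n + c)^c)`. [folklore] -/
theorem crux_iff :
    FixedWitnessObstructionQP ↔
      ∀ c : ℕ, ∃ n₀ : ℕ, ∀ n ≥ n₀, ∀ (m : ℕ) [NeZero m], n ≤ m → m ≤ 2 ^ ((Nat.log 2 n + c) ^ c) →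
        ¬ FixedWitnessAt n m :=
  Iff.rfl

/-- **Toric form of height `≤ B`.** The padded permanent `X₀₀^(m−n) per_n` is a translate (by
`u ∈ GL_{m²}`) of a weighted-homogeneous component (weight `w`, value `e`) of a translate
`g · det_m` of the determinant, with all weights `w i ≤ B`.  For the top component this is the
restriction of `g·det_m` to the face of its Newton polytope exposed by `w` — the form-level shadow
of a one-parameter-subgroup limit `lim_t Ann(u·diag((t+2)^w)·g·det_m)` of crux `ToricFixedPoints`. -/
def HasToricForm (n m B : ℕ) [NeZero m] : Prop :=
  ∃ (u g : Matrix.GeneralLinearGroup (Fin m × Fin m) ℂ) (w : Fin m × Fin m → ℕ) (e : ℕ),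
    (∀ i, w i ≤ B) ∧
    paddedPerPoly ℂ n m =
      linSubst (Fin m × Fin m) ℂ (u : Matrix (Fin m × Fin m) (Fin m × Fin m) ℂ)
        (MvPolynomial.weightedHomogeneousComponent w e
          (linSubst (Fin m × Fin m) ℂ (g : Matrix (Fin m × Fin m) (Fin m × Fin m) ℂ)
            (detPoly (Fin m) ℂ)))

/-! ## §1 The registered stubs -/

/-- **stub_formToric** (det-only structure, form level; size L).  An `H₀(n,m)`-fixed
border-apolar witness over the padded permanent forces a TORIC FORM of `pp`: by W5 in degree `m`
and `codim J_m = 1`, `J_m = Ann_m(pp)`; if the fixed point `J` is a one-parameter-subgroup limit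
`lim_t Ann(u·diag((t+2)^w)·g·det_m)` (crux `ToricFixedPoints`, or any iterated/non-saturated limit
whose degree-`m` socle is still a torus limit) then `[P_t] → [u · in_w(g·det_m)]`, so
`pp = u · wHC_w^e(g·det_m)` after absorbing the scalar into `u` and shifting `w` to `ℕ`.
Uses W1 (`false_without_orbit`) and W3 (`false_without_limsup`).  Kill: an `H₀`-fixed point of
`Z_det_m`, `m ∈ {3,4,5}`, whose degree-`m` socle is not a torus limit of a translate. -/
theorem stub_formToric :
    ∀ (n m : ℕ) [NeZero m], 3 ≤ n → n ≤ m → FixedWitnessAt n m → ∃ B : ℕ, HasToricForm n m B := by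
  sorry

/-- **stub_fixedHeightQP** (the load-bearing bet; size L/XL).  HEIGHT REDUCTION: at a pair
`(n, m)` carrying a fixed witness, a toric form of the padded permanent can be re-chosen with
weights of quasi-polynomial height `‖w‖_∞ ≤ 2^((log₂ m + c₀)^c₀)`, `c₀` absolute.  Two routes:
(polyhedral, witness-free = `toric-face-debordering`'s WeightBoundQP) the level set of `w` on
`supp(g·det_m)` carrying `u⁻¹·pp` is cut out by an integer functional that may be taken constant
on `T'`-weight classes of the `n!`-term `S_n × S_n`-symmetric support, shrinking the ambient
dimension of the Siegel/Cramer bound from `m²` to the number of classes; (fixed-point, uses the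
witness) Białynicki-Birula: a fixed point reached from the open cell is `in_λ(h·det_m^⊥)` for a
cocharacter `λ` of the `H₀`-torus that only has to induce the right preorder on the finitely many
torus weights of `T_{≤ m}`.  Adversary: Alon–Vũ / Ziegler (generic 0/1-polytopes in dimension
`d = m²` have facet normals `≥ (d−1)^((d−1)/2) / 2^(2d+o(d))`), so genericity must be broken by the
symmetry of the permanent-carrying level set.  Consistent data: every known boundary component
(`End(W)·det_m`, `P_Λ = lim det(A_skew + tS)`) and every Grenet-region membership has height `≤ 1`. -/
theorem stub_fixedHeightQP :
    ∃ c₀ : ℕ, ∀ (n m B : ℕ) [NeZero m], 3 ≤ n → n ≤ m → FixedWitnessAt n m →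
      HasToricForm n m B → HasToricForm n m (2 ^ ((Nat.log 2 m + c₀) ^ c₀)) := by
  sorry

/-- **stub_deborder** (interpolation de-bordering; size M, provable now).  A toric form of height
`B` de-borders at polynomial cost: with `F := g·det_m` (`HasDetRepr F m`, `hasDetRepr_linSubst`),
`F(s^w · x) = Σ_{e ≤ mB} s^e F_e(x)`; inverting the Vandermonde at `mB + 1` integer nodes writes
`wHC_w^e F = Σ_j c_j F(s_j^w x)`, a sum of `mB+1` size-`m` determinants of linear forms, hence
(determinant → ABP of size `O(m^4)`, parallel sum, ABP → determinant) of determinantal complexity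
`≤ C·(mB+1)·m^4 ≤ ((m+1)(B+1))^e₀`; translate by `u` (`hasDetRepr_linSubst`) and set `X₀₀ = 1`,
block `↦ Fin n × Fin n`, other variables `↦ 0` (`HasDetRepr.of_isProjection_holds`) to reach
`per_n`.  `e₀` absolute (the constant `C` is absorbed since `(m+1)(B+1) ≥ 2`).
Sources: Bürgisser, FoCM 4 (2004) §5 (Lemma 5.5(3): interpolation de-bordering at cost polynomial
in the order); Dutta–Gesmundo–Ikenmeyer–Jindal–Lysikov arXiv:2211.07055 p. 6; MahajanVinay1997;
Valiant1979; ApproximationOrderBound.lean docblock (LL89: general order bounds are exponential). -/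
theorem stub_deborder :
    ∃ e₀ : ℕ, ∀ (n m B : ℕ) [NeZero m], n ≤ m → HasToricForm n m B →
      HasDetRepr (perPoly (Fin n) ℂ) (((m + 1) * (B + 1)) ^ e₀) := by
  sorry

/-- **stub_dcPerEventuallySuperQP** (EXTERNAL HYPOTHESIS — the EVENTUAL dc-thesis: for every `c`,
for all large `n`, `dc(per_n) > 2^((log₂ n + c)^c)`; open problem, NOT to be attacked inside this
crux: it is the affine permanent-vs-determinant problem, staffed by route `DetQP`, whose
`DetqpThesis` (stmt-ValiantsHypothesis-0315, `¬ IsQPBounded dc(per_·)`) is its infinitely-often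
weakening; recommended to be filed as a support item shared by `BorderApolarity` and `DetQP`).
It is implied by the crux itself (`dc ≥ border-dc`, via `WitnessToMembership` + Disproof
`crux_iff_gctWindow`) and it alone implies VH (`DetQP.DcqpToVH`, proved), so this line makes X a
corollary of "det-only structure of fixed points + the affine lower bound": it ISOLATES the border
phenomenon, it does not remove the hardness of the permanent.  The i.o. form does NOT suffice:
`¬X` yields toric data only along a subsequence of `n`. -/
theorem stub_dcPerEventuallySuperQP :
    ∀ c : ℕ, ∃ n₀ : ℕ, ∀ n ≥ n₀,
      2 ^ ((Nat.log 2 n + c) ^ c) < determinantalComplexity (perPoly (Fin n) ℂ) := by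
  sorry

/-! ## §2 Quasi-polynomial arithmetic (proved) -/

/-- `qpoly ∘ qpoly ⊆ qpoly`, the exponent inequality: for all `c c₀ e₀` there is `c'` with
`e₀ · ((L+c)^c + ((L+c)^c + c₀)^c₀ + 2) ≤ (L + c')^c'` for every `L`. [folklore] -/
theorem qp_compose (c c₀ e₀ : ℕ) :
    ∃ c' : ℕ, ∀ L : ℕ, e₀ * ((L + c) ^ c + ((L + c) ^ c + c₀) ^ c₀ + 2) ≤ (L + c') ^ c' := by
  set K : ℕ := c + c₀ + e₀ + 2 with hK
  refine ⟨(K + 1) * K + 3, fun L => ?_⟩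
  set X : ℕ := L + K with hX
  have hX2 : 2 ≤ X := by omega
  have hX1 : 1 ≤ X := by omega
  have hcK : c ≤ K := by omega
  have hc₀K : c₀ ≤ K := by omega
  have he₀X : e₀ ≤ X := by omega
  have h1K : 1 ≤ (K + 1) * K := by nlinarith
  -- (L+c)^c ≤ X^K
  have hA : (L + c) ^ c ≤ X ^ K :=
    calc (L + c) ^ c ≤ X ^ c := Nat.pow_le_pow_left (by omega) c
      _ ≤ X ^ K := Nat.pow_le_pow_right hX1 hcK
  -- (L+c)^c + c₀ ≤ X^(K+1)
  have hB : (L + c) ^ c + c₀ ≤ X ^ (K + 1) := by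
    have hc₀X : c₀ ≤ X ^ K :=
      calc c₀ ≤ X := by omega
        _ = X ^ 1 := (pow_one X).symm
        _ ≤ X ^ K := Nat.pow_le_pow_right hX1 (by omega)
    calc (L + c) ^ c + c₀ ≤ X ^ K + X ^ K := Nat.add_le_add hA hc₀X
      _ = 2 * X ^ K := by ring
      _ ≤ X * X ^ K := Nat.mul_le_mul_right _ hX2
      _ = X ^ (K + 1) := by ring
  -- ((L+c)^c + c₀)^c₀ ≤ X^((K+1)*K)
  have hC : ((L + c) ^ c + c₀) ^ c₀ ≤ X ^ ((K + 1) * K) :=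
    calc ((L + c) ^ c + c₀) ^ c₀ ≤ (X ^ (K + 1)) ^ c₀ := Nat.pow_le_pow_left hB c₀
      _ ≤ (X ^ (K + 1)) ^ K := Nat.pow_le_pow_right (Nat.one_le_pow _ _ hX1) hc₀K
      _ = X ^ ((K + 1) * K) := by rw [← pow_mul]
  -- the sum
  have hXpow : X ≤ X ^ ((K + 1) * K) :=
    calc X = X ^ 1 := (pow_one X).symm
      _ ≤ X ^ ((K + 1) * K) := Nat.pow_le_pow_right hX1 h1K
  have hKpow : X ^ K ≤ X ^ ((K + 1) * K) := Nat.pow_le_pow_right hX1 (by nlinarith)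
  have h2X : 2 ≤ X ^ ((K + 1) * K) := le_trans hX2 hXpow
  have hS : (L + c) ^ c + ((L + c) ^ c + c₀) ^ c₀ + 2 ≤ X ^ ((K + 1) * K + 2) :=
    calc (L + c) ^ c + ((L + c) ^ c + c₀) ^ c₀ + 2
        ≤ X ^ ((K + 1) * K) + X ^ ((K + 1) * K) + X ^ ((K + 1) * K) :=
          Nat.add_le_add (Nat.add_le_add (hA.trans hKpow) hC) h2X
      _ = 3 * X ^ ((K + 1) * K) := by ring
      _ ≤ (X * X) * X ^ ((K + 1) * K) := Nat.mul_le_mul_right _ (by nlinarith)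
      _ = X ^ ((K + 1) * K + 2) := by ring
  calc e₀ * ((L + c) ^ c + ((L + c) ^ c + c₀) ^ c₀ + 2)
      ≤ X * X ^ ((K + 1) * K + 2) := Nat.mul_le_mul he₀X hS
    _ = X ^ ((K + 1) * K + 3) := by ring
    _ ≤ (L + ((K + 1) * K + 3)) ^ ((K + 1) * K + 3) := by
        apply Nat.pow_le_pow_left
        rw [hX]
        nlinarith

/-- The window arithmetic: if `m ≤ 2^A` then `(m+1)·(2^((log₂ m + c₀)^c₀) + 1) ≤ 2^(A + (A+c₀)^c₀ + 2)`.
[folklore] -/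
theorem window_bound {m A c₀ : ℕ} (hm : m ≤ 2 ^ A) :
    (m + 1) * (2 ^ ((Nat.log 2 m + c₀) ^ c₀) + 1) ≤ 2 ^ (A + ((A + c₀) ^ c₀) + 2) := by
  have hlog : Nat.log 2 m ≤ A :=
    calc Nat.log 2 m ≤ Nat.log 2 (2 ^ A) := Nat.log_mono_right hm
      _ = A := Nat.log_pow (by norm_num) A
  have h1 : m + 1 ≤ 2 ^ (A + 1) := by
    have : 1 ≤ 2 ^ A := Nat.one_le_two_pow
    calc m + 1 ≤ 2 ^ A + 2 ^ A := Nat.add_le_add hm this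
      _ = 2 ^ (A + 1) := by ring
  have h2 : 2 ^ ((Nat.log 2 m + c₀) ^ c₀) + 1 ≤ 2 ^ ((A + c₀) ^ c₀ + 1) := by
    have hle : (Nat.log 2 m + c₀) ^ c₀ ≤ (A + c₀) ^ c₀ := Nat.pow_le_pow_left (by omega) c₀
    have hp : 2 ^ ((Nat.log 2 m + c₀) ^ c₀) ≤ 2 ^ ((A + c₀) ^ c₀) := Nat.pow_le_pow_right (by norm_num) hle
    have : 1 ≤ 2 ^ ((A + c₀) ^ c₀) := Nat.one_le_two_pow
    calc 2 ^ ((Nat.log 2 m + c₀) ^ c₀) + 1 ≤ 2 ^ ((A + c₀) ^ c₀) + 2 ^ ((A + c₀) ^ c₀) :=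
          Nat.add_le_add hp this
      _ = 2 ^ ((A + c₀) ^ c₀ + 1) := by ring
  calc (m + 1) * (2 ^ ((Nat.log 2 m + c₀) ^ c₀) + 1)
      ≤ 2 ^ (A + 1) * 2 ^ ((A + c₀) ^ c₀ + 1) := Nat.mul_le_mul h1 h2
    _ = 2 ^ (A + ((A + c₀) ^ c₀) + 2) := by ring

/-! ## §3 The composition: stubs ⟹ the crux, by name -/

/-- **The reduction, with the four stub statements as explicit hypotheses** (sorry-free):
`formToric → fixedHeightQP → deborder → dcPerEventuallySuperQP → (X unfolded)`.  Given `c`, pick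
`c₀, e₀` from the stubs and `c'` from `qp_compose c c₀ e₀`, then `n₀` from the eventual dc-thesis
at `c'`; a fixed witness at `(n, m)` in the `c`-window with `n ≥ max n₀ 3` yields a toric form,
then one of height `2^((log₂ m + c₀)^c₀)`, then
`dc(per_n) ≤ ((m+1)(B+1))^e₀ ≤ 2^((log₂ n + c')^c')` by `window_bound` + `qp_compose` —
contradicting `dc(per_n) > 2^((log₂ n + c')^c')`. [folklore] -/
theorem line_reduction
    (hT : ∀ (n m : ℕ) [NeZero m], 3 ≤ n → n ≤ m → FixedWitnessAt n m → ∃ B : ℕ, HasToricForm n m B)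
    (hH : ∃ c₀ : ℕ, ∀ (n m B : ℕ) [NeZero m], 3 ≤ n → n ≤ m → FixedWitnessAt n m →
      HasToricForm n m B → HasToricForm n m (2 ^ ((Nat.log 2 m + c₀) ^ c₀)))
    (hD : ∃ e₀ : ℕ, ∀ (n m B : ℕ) [NeZero m], n ≤ m → HasToricForm n m B →
      HasDetRepr (perPoly (Fin n) ℂ) (((m + 1) * (B + 1)) ^ e₀))
    (hE : ∀ c : ℕ, ∃ n₀ : ℕ, ∀ n ≥ n₀,
      2 ^ ((Nat.log 2 n + c) ^ c) < determinantalComplexity (perPoly (Fin n) ℂ)) :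
    ∀ c : ℕ, ∃ n₀ : ℕ, ∀ n ≥ n₀, ∀ (m : ℕ) [NeZero m], n ≤ m → m ≤ 2 ^ ((Nat.log 2 n + c) ^ c) →
      ¬ FixedWitnessAt n m := by
  obtain ⟨c₀, hH⟩ := hH
  obtain ⟨e₀, hD⟩ := hD
  intro c
  obtain ⟨c', hc'⟩ := qp_compose c c₀ e₀
  obtain ⟨n₀, hn₀⟩ := hE c'
  refine ⟨max n₀ 3, fun n hn m _ hnm hm hw => ?_⟩
  have h3 : 3 ≤ n := le_trans (le_max_right _ _) hn
  have hn' : n ≥ n₀ := le_trans (le_max_left _ _) hn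
  obtain ⟨B, hB⟩ := hT n m h3 hnm hw
  have hsmall := hH n m B h3 hnm hw hB
  have hrep := hD n m _ hnm hsmall
  have hdc := determinantalComplexity_le_of_hasDetRepr hrep
  have hbig := hn₀ n hn'
  -- arithmetic: the de-bordered size is quasi-polynomial in n inside the window
  have hwin := window_bound (c₀ := c₀) hm
  have hexp := hc' (Nat.log 2 n)
  have hchain : ((m + 1) * (2 ^ ((Nat.log 2 m + c₀) ^ c₀) + 1)) ^ e₀ ≤ 2 ^ ((Nat.log 2 n + c') ^ c') :=
    calc ((m + 1) * (2 ^ ((Nat.log 2 m + c₀) ^ c₀) + 1)) ^ e₀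
        ≤ (2 ^ ((Nat.log 2 n + c) ^ c + (((Nat.log 2 n + c) ^ c + c₀) ^ c₀) + 2)) ^ e₀ :=
          Nat.pow_le_pow_left hwin e₀
      _ = 2 ^ (e₀ * ((Nat.log 2 n + c) ^ c + (((Nat.log 2 n + c) ^ c + c₀) ^ c₀) + 2)) := by
          rw [← pow_mul, mul_comm]
      _ ≤ 2 ^ ((Nat.log 2 n + c') ^ c') := Nat.pow_le_pow_right (by norm_num) hexp
  exact absurd (lt_of_lt_of_le hbig (hdc.trans hchain)) (lt_irrefl _)

/-- **The line closes the crux, by name.**  The registered stubs plugged into `line_reduction`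
and transported along `crux_iff`; the only `sorry`s in its cone are the four `stub_*`. [folklore] -/
theorem FixedWitnessObstructionQP_of : FixedWitnessObstructionQP :=
  crux_iff.2 (line_reduction stub_formToric stub_fixedHeightQP stub_deborder stub_dcPerEventuallySuperQP)

end

end Summit.ValiantsHypothesis.ValiantsHypothesis.Cruxes.FixedWitnessObstructionQP.FixedPointDebordering
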